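import Summits.SmoothPoincare4.SmoothPoincare4.Theses.IsotropicCorkBracketing
import Literature.Topology.FourManifolds.CorkPresentationHomotopySphere
import Literature.Topology.FourManifolds.HomotopyS4OrientableProofs
import HarnessLib

/-!
# SmoothPoincare4 / IsotropicCorkBracketing — `CorkPresentation` from its two named facts

Item stmt-SmoothPoincare4-11213 (support `CorkPresentation` of route `SmoothPoincare4/IsotropicCorkBracketing`,
hypothesis `_hP` of its `closes` theorem): every smooth closed `M ≃ₕ S⁴` is a cork twist
`C ∪_(φ ∘ τ) W` of the standard `S⁴ = C ∪_φ W` (`C` compact contractible, `W` compact, both smooth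
4-manifolds with boundary, `τ ∈ Diff(∂C)`), with the boundary data and both gluings UNBUNDLED into
the summit's binders (the fields of `Literature.Topology.FourManifolds.BoundaryData` and the
definiens of `Literature.Topology.FourManifolds.IsBoundaryGluing`).

The item is a NAMED-FACT item: it is the unbundled form of the tree's PROVED packaging
`Literature.Topology.FourManifolds.HomotopySphere.exists_corkPresentation_of_facts`
(`CorkPresentationHomotopySphere.lean`), which combines the two named facts

* `Literature.Topology.FourManifolds.isHCobordant_sphere_of_homotopySphere_four` — `Θ₄ = 0`
  (Kervaire–Milnor 1963, table p. 504: every homotopy 4-sphere is h-cobordant to `S⁴`), and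
* `Literature.Topology.FourManifolds.Matveyev1996_decomposition` — the cork decomposition theorem in
  Matveyev's printed two-piece form (Matveyev 1996, Theorem parts 1–2; Curtis–Freedman–Hsiang–Stong
  1996),

neither of which is proved in the tree (both XL).  This file proves the item CONDITIONALLY on exactly
these two facts (`corkPresentation_of_facts`; the gate records `conditional-result`): package
`M ≃ₕ S⁴` as a `HomotopySphere 4` using the PROVED discharges
`compactSpace_of_homotopyEquiv_sphere_four_holds` (Hatcher Prop. 3.29) and
`isOrientable_of_homotopyEquiv_sphere_four_holds` (Lee Thm. 15.43), apply the tree lemma, and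
destructure `BoundaryData` / `IsBoundaryGluing`.

References: R. Matveyev, J. Differential Geom. 44 (1996) 571–582, Theorem [Matveyev1996];
C. Curtis, M. Freedman, W.-C. Hsiang, R. Stong, Invent. Math. 123 (1996) 343–348
[CurtisFreedmanHsiangStong1996]; M. Kervaire, J. Milnor, Ann. of Math. 77 (1963), table p. 504
[KervaireMilnorAnnals1963].
-/

-- the prescribed namespace `Summit.<P>.<Sub>.…` duplicates `SmoothPoincare4` (P = Sub)
set_option linter.dupNamespace false

noncomputable section

open scoped Manifold ContDiff Topology
open Set Function Literature.Topology.FourManifolds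
open Summit.SmoothPoincare4.SmoothPoincare4.Theses.IsotropicCorkBracketing (CorkPresentation)

namespace Summit.SmoothPoincare4.SmoothPoincare4.Theorems

/-- **Fidelity certificate: the item `CorkPresentation` is, verbatim up to (un)bundling, the
statement (F1) "every homotopy 4-sphere is a cork twist of `S⁴` with compact smooth exterior"**
— the conclusion of the tree's `HomotopySphere.exists_corkPresentation_of_facts`, quantified over
`Literature.Topology.FourManifolds.HomotopySphere 4` with bundled `BoundaryData` / `IsBoundaryGluing`.
`→`: a homotopy sphere `S` is a smooth closed `S.carrier ≃ₕ S⁴`; rebundle `⟨ZC, ιC, _, _⟩` as a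
`BoundaryData` (the gluing relations are then definitionally those of `IsBoundaryGluing`).
`←`: a smooth closed `M ≃ₕ S⁴` is compact (`compactSpace_of_homotopyEquiv_sphere_four_holds`,
Hatcher Prop. 3.29) and orientable (`isOrientable_of_homotopyEquiv_sphere_four_holds`, Lee
Thm. 15.43), hence with a chosen orientation a `HomotopySphere 4`; unbundle the fields of
`BoundaryData` and destructure both `IsBoundaryGluing`s.  In particular the item is exactly as
strong as (F1), which the tree derives from `Θ₄ = 0` and the cork theorem.
[cite: Matveyev1996, Theorem (parts 1–2)] [cite: CurtisFreedmanHsiangStong1996, Theorem] -/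
theorem corkPresentation_iff_forall_homotopySphere :
    CorkPresentation ↔
      ∀ S : HomotopySphere 4, ∃ (C : Type) (_ : TopologicalSpace C) (_ : T2Space C)
        (_ : SecondCountableTopology C) (_ : ChartedSpace (EuclideanHalfSpace 4) C)
        (_ : IsManifold (𝓡∂ 4) ∞ C) (_ : CompactSpace C) (_ : ContractibleSpace C)
        (bC : BoundaryData (𝓡∂ 4) C (𝓡 3))
        (W : Type) (_ : TopologicalSpace W) (_ : T2Space W) (_ : SecondCountableTopology W)
        (_ : ChartedSpace (EuclideanHalfSpace 4) W) (_ : IsManifold (𝓡∂ 4) ∞ W) (_ : CompactSpace W)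
        (bW : BoundaryData (𝓡∂ 4) W (𝓡 3))
        (φ : bC.carrier ≃ₘ⟮𝓡 3, 𝓡 3⟯ bW.carrier) (τ : bC.carrier ≃ₘ⟮𝓡 3, 𝓡 3⟯ bC.carrier),
        IsBoundaryGluing bC bW φ (𝓡 4) (Metric.sphere (0 : EuclideanSpace ℝ (Fin 5)) 1) ∧
          IsBoundaryGluing bC bW (τ.trans φ) (𝓡 4) S.carrier := by
  constructor
  · intro h S
    obtain ⟨C, tC, t2C, scC, chC, mC, hc, hk, ZC, tZC, chZC, mZC, ιC, hιC, hrC, W, tW, t2W, scW,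
      chW, mW, hcW, ZW, tZW, chZW, mZW, ιW, hιW, hrW, φ, τ, ⟨kC, kW, hkC, hkW, hkU, hkR⟩,
      ⟨jC, jW, hjC, hjW, hjU, hjR⟩⟩ := h S.carrier S.nonempty_homotopyEquiv.some
    -- rebundle the boundary data; the gluing relations are definitionally those of
    -- `IsBoundaryGluing ⟨ZC, ιC, _, _⟩ ⟨ZW, ιW, _, _⟩` (instances are passed by name: anonymous
    -- `‹_›` placeholders leave pending metavariables in the binder types and make the
    -- elaborator unfold `ModelWithCorners.boundary` until it times out)
    refine ⟨C, tC, t2C, scC, chC, mC, hc, hk, ⟨ZC, ιC, hιC, hrC⟩, W, tW, t2W, scW, chW, mW, hcW,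
      ⟨ZW, ιW, hιW, hrW⟩, φ, τ, ?_, ?_⟩
    · exact ⟨kC, kW, hkC, hkW, hkU, hkR⟩
    · exact ⟨jC, jW, hjC, hjW, hjU, hjR⟩
  · intro h M _ _ _ _ _ e
    haveI : CompactSpace M := compactSpace_of_homotopyEquiv_sphere_four_holds M e
    -- `M`, with a chosen orientation, as a `HomotopySphere 4`
    let S : HomotopySphere 4 :=
      { carrier := M
        orientation := Classical.choice (isOrientable_of_homotopyEquiv_sphere_four_holds M e)
        nonempty_homotopyEquiv := ⟨e⟩ }
    obtain ⟨C, tC, t2C, scC, chC, mC, hc, hk, bC, W, tW, t2W, scW, chW, mW, hcW, bW, φ, τ,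
      ⟨kC, kW, hkC, hkW, hkU, hkR⟩, ⟨jC, jW, hjC, hjW, hjU, hjR⟩⟩ := h S
    -- unbundle `bC`, `bW` (fields of `BoundaryData`) and both gluings
    refine ⟨C, tC, t2C, scC, chC, mC, hc, hk, bC.carrier, bC.topologicalSpace, bC.chartedSpace,
      bC.isManifold, bC.incl, bC.isSmoothEmbedding, bC.range_incl, W, tW, t2W, scW, chW, mW, hcW,
      bW.carrier, bW.topologicalSpace, bW.chartedSpace, bW.isManifold, bW.incl,
      bW.isSmoothEmbedding, bW.range_incl, φ, τ, ?_, ?_⟩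
    · exact ⟨kC, kW, hkC, hkW, hkU, hkR⟩
    · exact ⟨jC, jW, hjC, hjW, hjU, hjR⟩

/-- **`IsotropicCorkBracketing.CorkPresentation` from `Θ₄ = 0` and Matveyev's cork theorem**
(item stmt-SmoothPoincare4-11213, CONDITIONAL on the two named facts
`isHCobordant_sphere_of_homotopySphere_four` and `Matveyev1996_decomposition.{0}`): every smooth
closed `M ≃ₕ S⁴` is `C ∪_(φ ∘ τ) W` where `S⁴ = C ∪_φ W`, `C` compact contractible, `W` compact,
`τ ∈ Diff(∂C)`, with boundary data and gluings unbundled.  Proof: the bundled form (F1) is the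
tree's PROVED `HomotopySphere.exists_corkPresentation_of_facts hΘ hM` (`Σ` simply connected and
h-cobordant to `S⁴` by `Θ₄ = 0`; Matveyev parts 1–2 give `S⁴ = W₁ ∪_{φ₁} N`, `Σ = W₂ ∪_{φ₂} N`,
`g : W₁ ≅ W₂`; `C = W₁`, `W = N`, `τ = ∂g ≫ φ₂ ≫ φ₁⁻¹`), and the item is its unbundling
(`corkPresentation_iff_forall_homotopySphere`).
[cite: Matveyev1996, Theorem (parts 1–2)] [cite: KervaireMilnorAnnals1963, table p. 504 (Θ₄ = 0)]
[cite: CurtisFreedmanHsiangStong1996, Theorem] -/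
theorem corkPresentation_of_facts
    (hΘ : isHCobordant_sphere_of_homotopySphere_four) (hM : Matveyev1996_decomposition.{0}) :
    CorkPresentation :=
  corkPresentation_iff_forall_homotopySphere.2 (HomotopySphere.exists_corkPresentation_of_facts hΘ hM)

end Summit.SmoothPoincare4.SmoothPoincare4.Theorems

end
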